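import Summits.NavierStokesRegularity.FluidComputer.GeometricFace
import Summits.NavierStokesRegularity.NavierStokesRegularity.Theorems.FluidComputerCascade
import Literature.Analysis.FluidPDE.TypeIGradientThreshold
import HarnessLib

/-!
# Fluid computer — L63: CHAE'S TYPE-I GRADIENT THRESHOLD HOLDS FOR NAVIER–STOKES BLOW-UP, CONSTANT ONE:
# `limsup_{t↑T} (T − t)·‖∇u(t)‖_∞ ≥ 1`

HONEST FRAMING (cell `pub-fluidc`, verbatim): *low prior, high value-of-information experiment on Tao's
machine paradigm; NOT a claim that NS blows up.* Theorem side of the cell (the level dictionary); nothing here is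
evidence of blow-up — necessities for EVERY maximal smooth finite-energy solution on `ℝ³`.

Row E2 of the dictionary (`EulerFace.euler_typeI_threshold`) is Chae's theorem for the cell's EULER controls: at a
genuine Euler blow-up `(T − t)·max_x ‖∇u(t, x)‖` exceeds every `M₀ < 1` arbitrarily close to `T`. The tree's kernel
theorem `exists_typeI_gradient_gt_of_not_hasSobolevExtensionPast` (`Literature/Analysis/FluidPDE/TypeIGradientThreshold`,
every `ν ≥ 0`: the viscous term only improves the maximum principle for `|ω|²`, and Beale–Kato–Majda holds for
`ν ≥ 0`) makes the SAME threshold a necessity for the VISCOUS class of the dictionary, the class hypothesis (all Sobolev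
norms bounded on closed interior sub-slabs) being discharged by Tao's persistence of regularity
(`GeometricFace.hasBoundedSobolevNormsOn_translate`, gen 15). Along every maximal smooth solution `(u, p)` of the
unforced Navier–Stokes system on `ℝ³ × [0, T)` (`ν > 0`) which is Leray–Hopf from `u 0`:

* `ns_typeI_gradient_threshold` (**L63 — THE TYPE-I GRADIENT THRESHOLD, CONSTANT ONE**): for every `M₀ < 1` and every
  `t₀ ∈ [0, T)` there are `t ∈ [t₀, T)` and `x` with `M₀ < (T − t)·‖∇u(t, x)‖` (`∇u = fderiv`, operator norm) —
  `limsup_{t↑T} (T − t)‖∇u(t)‖_∞ ≥ 1`: Chae's dichotomy `M(T) = 0` or `M(T) ≥ 1` for Navier–Stokes;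
* `ns_typeI_gradient_frequently` — filter form: for every `M₀ < 1`, `∃ᶠ t in 𝓝[<] T, ∃ x, M₀ < (T − t)‖∇u(t, x)‖`;
* `ns_typeI_gradient_iSup` — sup form: for every `M₀ < 1`, `∃ᶠ t in 𝓝[<] T, M₀/(T − t) < sup_x ‖∇u(t, x)‖`;
* `ns_typeI_gradient_threshold_of_cascadeWitness` — the interface reading.

Placement in the dictionary: L60/L61/L62 bound quantities with the SCALING of `‖∇u‖_∞` that DOMINATE it
(`(Y_{5−δ}Y_{5+δ})^{1/4}`, the `Ḃ^{5/2}_{2,1}` row `P ≳ ∑_l 2^l‖Δ̇_l u‖_∞ ≳ ‖∇u‖_∞`, the `Ḃ^{5/2}_{2,2}` row) from below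
with inexplicit absolute constants; L63 bounds the SMALLER quantity `‖∇u(t)‖_∞` itself, along a sequence of times,
with the EXPLICIT constant `1` — neither implies the other. HONEST PLACEMENT: the argument is Chae 2010, Thm. 1.1
(stated there for Euler) run with the viscous maximum principle and Beale–Kato–Majda for `ν ≥ 0` (the tree's
`TypeIGradientThreshold`, whose docstring records that no printed statement for Navier–Stokes was located; a
folklore-level consequence of BKM). A bound at EVERY `t` (`‖∇u(t)‖_∞ ≥ c/(T − t)`) is NOT claimed. Necessity only.
0 sorry; no definitions; no named facts.

## References

* D. Chae, J. Funct. Anal. 258 (2010) 2865–2883 = arXiv:0711.1113, Thm. 1.1 and its proof (p. 3–4). [Chae2010]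
* J. T. Beale, T. Kato, A. Majda, Comm. Math. Phys. 94 (1984) 61–66, Thm. 1 and the closing remark (`ν ≥ 0`).
  [BealeKatoMajda1984]
* A. J. Majda, A. L. Bertozzi, *Vorticity and Incompressible Flow*, CUP 2002, Thm. 3.6, remark p. 117.
  [MajdaBertozziCUP2002]
* T. Tao, Anal. PDE 6 (2013) = arXiv:1108.1165, Cor. 11.1 (persistence of regularity; the class hypothesis). [Tao2011]
-/

noncomputable section

open MeasureTheory Set Function Filter Topology Metric
open scoped ENNReal NNReal
open Literature.Analysis.FluidPDE Literature.Analysis.FunctionSpaces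
open Literature.Analysis.FluidPDE.FluidComputer
open Summit.NavierStokesRegularity.NavierStokesRegularity.Theorems.FluidComputer (x5a_of_cascadeWitness')

namespace Summit.NavierStokesRegularity.FluidComputer.TypeIGradientFace

/-! ## L63: the Type-I gradient threshold for Navier–Stokes blow-up -/

/-- **L63 — CHAE'S TYPE-I GRADIENT THRESHOLD FOR NAVIER–STOKES, CONSTANT ONE.** For every `ν > 0`, `T > 0`, every
maximal smooth solution `(u, p)` of the unforced Navier–Stokes system on `ℝ³ × [0, T)` which is Leray–Hopf from `u 0`,
every `M₀ < 1` and every `t₀ ∈ [0, T)`, there are `t ∈ [t₀, T)` and `x ∈ ℝ³` with `M₀ < (T − t)·‖∇u(t, x)‖`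
(`∇u(t, x) = fderiv ℝ (u t) x`, operator norm) — `limsup_{t↑T} (T − t)‖∇u(t)‖_∞ ≥ 1`. Proof: translate to the interior
time `s = (t₀ + T)/2` (`IsMaximalSmoothSolution.translate_zero`); the translate is a maximal classical solution on
`[0, T − s)` with all Sobolev norms bounded on every closed sub-slab (`GeometricFace.hasBoundedSobolevNormsOn_translate`),
hence with no continuation in the Beale–Kato–Majda class past `T − s`, and the kernel theorem
`exists_typeI_gradient_gt_of_not_hasSobolevExtensionPast` (`ν ≥ 0`: vorticity maximum principle under the gradient bound
+ Beale–Kato–Majda) applies. In words for the machine paradigm: a viscous design whose `(T − t)·max|∇u|` settles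
below `1` is NOT approaching a singularity at that `T` — the same scale-invariant diagnostic with the same explicit
threshold as for the Euler controls (E2). Necessity only; a bound at every `t` is not claimed.
[cite: Chae2010, Thm 1.1 (proof, arXiv:0711.1113 p. 3–4)] [cite: BealeKatoMajda1984, Thm. 1] [cite: Tao2011, Cor. 11.1] -/
theorem ns_typeI_gradient_threshold {ν T : ℝ} (hν : 0 < ν) (hT : 0 < T)
    {u : ℝ → EuclideanSpace ℝ (Fin 3) → EuclideanSpace ℝ (Fin 3)} {p : ℝ → EuclideanSpace ℝ (Fin 3) → ℝ}
    (hmax : IsMaximalSmoothSolution ν 0 u p T) (hLH : IsLerayHopfOn T ν 0 (u 0) u)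
    {M₀ : ℝ} (hM₀ : M₀ < 1) {t₀ : ℝ} (ht₀ : t₀ ∈ Ico 0 T) :
    ∃ t ∈ Ico t₀ T, ∃ x : EuclideanSpace ℝ (Fin 3), M₀ < (T - t) * ‖fderiv ℝ (u t) x‖ := by
  -- an interior anchor `s ∈ (t₀, T)`, `s > 0`
  set s : ℝ := (t₀ + T) / 2 with hsdef
  have hs : s ∈ Ioo 0 T := ⟨by rw [hsdef]; linarith [ht₀.1, ht₀.2], by rw [hsdef]; linarith [ht₀.2]⟩
  have ht₀s : t₀ < s := by rw [hsdef]; linarith [ht₀.2]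
  have hTs : 0 < T - s := sub_pos.2 hs.2
  -- the translate: maximal, in the BKM class on closed sub-slabs, hence not continuable in the class
  have hmaxs : IsMaximalSmoothSolution ν 0 (fun t => u (t + s)) (fun t => p (t + s)) (T - s) :=
    hmax.translate_zero hs.1 hs.2
  have hregs : ∀ T'' < T - s, HasBoundedSobolevNormsOn (Icc 0 T'') (fun t => u (t + s)) := fun T'' hT'' =>
    GeometricFace.hasBoundedSobolevNormsOn_translate hν hT hmax hLH hs hT''
  have hblow : ¬ HasSobolevExtensionPast ν (fun t => u (t + s)) (T - s) := fun hext =>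
    hmaxs.2 hext.hasSmoothExtensionPast
  -- the kernel theorem on the translate, from time `0`
  obtain ⟨t', ht', x, hx⟩ := exists_typeI_gradient_gt_of_not_hasSobolevExtensionPast hν.le hTs hmaxs.1 hregs hblow
    hM₀ (t₀ := 0) ⟨le_rfl, hTs⟩
  refine ⟨t' + s, ⟨by linarith [ht'.1], by linarith [ht'.2]⟩, x, ?_⟩
  have e : T - (t' + s) = T - s - t' := by ring
  rw [e]
  exact hx

/-- **L63, filter form**: along every maximal smooth Leray–Hopf solution of the unforced system (`ν > 0`), for every
`M₀ < 1`: `∃ᶠ t in 𝓝[<] T, ∃ x, M₀ < (T − t)·‖∇u(t, x)‖` — i.e. `limsup_{t↑T} (T − t)‖∇u(t)‖_∞ ≥ 1`.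
[cite: Chae2010, Thm 1.1] [cite: BealeKatoMajda1984, Thm. 1] -/
theorem ns_typeI_gradient_frequently {ν T : ℝ} (hν : 0 < ν) (hT : 0 < T)
    {u : ℝ → EuclideanSpace ℝ (Fin 3) → EuclideanSpace ℝ (Fin 3)} {p : ℝ → EuclideanSpace ℝ (Fin 3) → ℝ}
    (hmax : IsMaximalSmoothSolution ν 0 u p T) (hLH : IsLerayHopfOn T ν 0 (u 0) u)
    {M₀ : ℝ} (hM₀ : M₀ < 1) :
    ∃ᶠ t in 𝓝[<] T, ∃ x : EuclideanSpace ℝ (Fin 3), M₀ < (T - t) * ‖fderiv ℝ (u t) x‖ := by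
  rw [Filter.frequently_iff]
  intro U hU
  obtain ⟨l, hl, hlU⟩ := mem_nhdsLT_iff_exists_Ioo_subset.1 hU
  -- start strictly after `max l 0`
  set t₀ : ℝ := (max l 0 + T) / 2 with ht₀def
  have hm : max l 0 < T := max_lt hl hT
  have ht₀ : t₀ ∈ Ico 0 T := ⟨by rw [ht₀def]; linarith [le_max_right l 0], by rw [ht₀def]; linarith⟩
  have hlt₀ : l < t₀ := by rw [ht₀def]; linarith [le_max_left l 0]
  obtain ⟨t, ht, x, hx⟩ := ns_typeI_gradient_threshold hν hT hmax hLH hM₀ ht₀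
  exact ⟨t, hlU ⟨hlt₀.trans_le ht.1, ht.2⟩, x, hx⟩

/-- **L63, sup form**: along every maximal smooth Leray–Hopf solution of the unforced system (`ν > 0`), for every
`M₀ < 1`: `∃ᶠ t in 𝓝[<] T, M₀/(T − t) < sup_x ‖∇u(t, x)‖` (extended-real supremum of the pointwise operator norms).
[cite: Chae2010, Thm 1.1] [cite: BealeKatoMajda1984, Thm. 1] -/
theorem ns_typeI_gradient_iSup {ν T : ℝ} (hν : 0 < ν) (hT : 0 < T)
    {u : ℝ → EuclideanSpace ℝ (Fin 3) → EuclideanSpace ℝ (Fin 3)} {p : ℝ → EuclideanSpace ℝ (Fin 3) → ℝ}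
    (hmax : IsMaximalSmoothSolution ν 0 u p T) (hLH : IsLerayHopfOn T ν 0 (u 0) u)
    {M₀ : ℝ} (hM₀ : M₀ < 1) :
    ∃ᶠ t in 𝓝[<] T, ENNReal.ofReal (M₀ / (T - t)) < ⨆ x : EuclideanSpace ℝ (Fin 3), ‖fderiv ℝ (u t) x‖ₑ := by
  -- work with `M₁ = max M₀ 0 ∈ [0, 1)` so that the real threshold is non-negative
  set M₁ : ℝ := max M₀ 0 with hM₁
  have hM₁1 : M₁ < 1 := max_lt hM₀ one_pos
  have hM₁0 : 0 ≤ M₁ := le_max_right _ _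
  have h := ns_typeI_gradient_frequently hν hT hmax hLH hM₁1
  have hlt : ∀ᶠ t in 𝓝[<] T, t < T := eventually_nhdsWithin_of_forall fun t ht => ht
  refine (h.and_eventually hlt).mono fun t ⟨⟨x, hx⟩, htT⟩ => ?_
  have hTt : 0 < T - t := sub_pos.2 htT
  have h1 : M₁ / (T - t) < ‖fderiv ℝ (u t) x‖ := by
    rw [div_lt_iff₀ hTt]
    linarith
  have h1pos : 0 < ‖fderiv ℝ (u t) x‖ := lt_of_le_of_lt (div_nonneg hM₁0 hTt.le) h1
  have h0 : M₀ / (T - t) ≤ M₁ / (T - t) := div_le_div_of_nonneg_right (le_max_left _ _) hTt.le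
  calc ENNReal.ofReal (M₀ / (T - t)) ≤ ENNReal.ofReal (M₁ / (T - t)) := ENNReal.ofReal_le_ofReal h0
    _ < ‖fderiv ℝ (u t) x‖ₑ := by
        rw [← ofReal_norm]
        exact (ENNReal.ofReal_lt_ofReal_iff h1pos).2 h1
    _ ≤ ⨆ y : EuclideanSpace ℝ (Fin 3), ‖fderiv ℝ (u t) y‖ₑ := le_iSup (fun y => ‖fderiv ℝ (u t) y‖ₑ) x

/-! ## The interface reading -/

/-- **L63 READ ON THE INTERFACE: every cascade witness has `limsup_{t↑T} (T − t)‖∇u(t)‖_∞ ≥ 1`.** Every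
`W : CascadeWitness` yields `ν > 0`, `T > 0` and a maximal smooth solution `(u, p)` of the unforced Navier–Stokes system
on `ℝ³ × [0, T)`, Leray–Hopf from `u 0` (`x5a_of_cascadeWitness'`), such that for every `M₀ < 1` and every
`t₀ ∈ [0, T)` some `t ∈ [t₀, T)` and `x` have `M₀ < (T − t)·‖∇u(t, x)‖`. [cite: Chae2010, Thm 1.1]
[cite: BealeKatoMajda1984, Thm. 1] -/
theorem ns_typeI_gradient_threshold_of_cascadeWitness (W : CascadeWitness) :
    ∃ ν : ℝ, 0 < ν ∧ ∃ T : ℝ, 0 < T ∧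
      ∃ (u : ℝ → EuclideanSpace ℝ (Fin 3) → EuclideanSpace ℝ (Fin 3)) (p : ℝ → EuclideanSpace ℝ (Fin 3) → ℝ),
        IsMaximalSmoothSolution ν 0 u p T ∧ IsLerayHopfOn T ν 0 (u 0) u ∧
        ∀ M₀ : ℝ, M₀ < 1 → ∀ t₀ ∈ Ico 0 T,
          ∃ t ∈ Ico t₀ T, ∃ x : EuclideanSpace ℝ (Fin 3), M₀ < (T - t) * ‖fderiv ℝ (u t) x‖ := by
  obtain ⟨ν, hν, T, hT, u, p, hmax, hLH, -⟩ := x5a_of_cascadeWitness' W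
  exact ⟨ν, hν, T, hT, u, p, hmax, hLH, fun _ hM₀ _ ht₀ => ns_typeI_gradient_threshold hν hT hmax hLH hM₀ ht₀⟩

end Summit.NavierStokesRegularity.FluidComputer.TypeIGradientFace

end
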